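/-
Origin: expansion seat `literature-prover-pub-hodgecm-cf-rogawski-g6-0`, handover #2 v2 2026-08-18T11:43:43Z md5 d68e3275 (DOC-ONLY whole-file replacement of the r21 tree file b8f9d30f2163 minus its 4-line Origin header; code byte-identical modulo comments; 300 l.) (`HOME/pub-hodgecm-cf-rogawski-g6/ThetaLiftExhaustion.lean`, md5 d68e3275, 300 lines);
landed by the gen-8 packager in gate run 29 REPLACES the earlier landed copy of `HodgeCM/Literature/ThetaLiftExhaustion.lean` (verbatim).
-/
/-
Copyright: pub-hodgecm formalisation cell (harness21, 2026). New file (not vendored).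
Origin: HOME/pub-hodgecm-cf-rogawski/ThetaLiftExhaustion.lean — CITED-FACT seat (4), session
literature-prover-pub-hodgecm-cf-rogawski-0, 2026-08-18. Suggested target: `HodgeCM/Literature/ThetaLiftExhaustion.lean`.
Independent of `HodgeCM/Literature/Rogawski.lean` and `RogawskiConsequences.lean` (imports Mathlib only).
v2 (2026-08-18, session literature-prover-pub-hodgecm-cf-rogawski-g6-0, `HOME/pub-hodgecm-cf-rogawski-g6/ThetaLiftExhaustion.lean`):
DOCSTRING-ONLY delta over the landed v1 (run 21) — the PUBLISHED version (Acta Math. 216 (2016)) was read: its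
NUMBERING (Thm 7.2 / Cor 7.3 / Def 7.1 / §7.3 / §7.5 = the arXiv-numbered Thm 7.8 / Cor 7.9 / Def 7.5 / §7.4 / §7.7
quoted here and by PerL) and its wording of the source's STATUS (§1.4 pp. 8–9, §12.5 p. 94, Appendix A.2) are recorded
in the module docstring; no declaration, statement, name or proof changed (`HOME/GAPS.md` cfR6-N3, `CITED-FACTS.md` R7b).
-/
import Mathlib

/-!
# Cited fact: low-degree cohomological automorphic representations of anisotropic unitary groups are
# `ψ`-theta lifts from smaller unitary groups — Bergeron–Millson–Moeglin, Thm 7.8 / Cor 7.9 (arXiv numbering;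
# = Acta Math. 216 (2016) Theorem 7.2 / Corollary 7.3)

WHAT IS TYPED HERE AND WHY.  PerL v5 §1.4, tex ll. 110–112: "For orientation only (it is not used in the proofs
below): every `π ∈ 𝒜^{1,0}` is a global theta lift from the unitary group of a hermitian *line* over `L`; over an
arbitrary totally real base this is Bergeron--Millson--Moeglin [BMM, Thm. 7.8, Cor. 7.9] (recorded for the sextic
field as [Y1neg, (P1)])."  `[BMM]` = PerL bibitem l. 710 = N. Bergeron, J. Millson, C. Moeglin, *The Hodge conjecture
and arithmetic quotients of complex balls*, Acta Math. 216 (2016), no. 1, 1–125, doi 10.1007/s11511-016-0136-2 =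
arXiv:1306.1515 — HELD as corpus text `paper:arxiv-1306.1515` (a 69-chunk extraction of the arXiv source; below,
"chunk pNNNN Lk" locates the quoted sentence in the held text).  NUMBERING: the extraction renumbers environments
sequentially and restarts section numbers in each Part; the printed numbers used here (PerL's "Thm 7.8, Cor 7.9";
§6 = arXiv Part 2 §1 "Shimura varieties and their cohomology", §7 = Part 2 §2 "The global theta correspondence") are
consistent with the source's own labels (`Thm:main9` for the main theorem of Part 2 §4, "§(10.1)" for Part 3 §1.1),
and the identification "Thm 7.8 = extraction 'Theorem 64', Cor 7.9 = 'Corollary 65', Def 7.5 = 'Definition 63'" is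
forced: these are the only Theorem / Corollary / Definition environments of §7 (chunks p0033–p0034).  VERBATIMNESS:
the extraction drops some user macros (`\U`, `\GU`, `\A`, `\C`, `\Q`: "smaller group `(W)`", "`H^{b×q,a×q}(S, )`");
in the quotations below these symbols are restored from the context (§6.2, §6.8, §7.4) and everything else is as held.
PUBLISHED VERSION (v2; read 2026-08-18 in the open-access Acta Math. copy, Project Euclid
`journalArticle/Download?urlId=10.1007%2Fs11511-016-0136-2`, materialised as `paper:url-74f0819951c5`, 129 PDF pages,
PRINTED PAGE = PDF PAGE − 4; "Acta Math., 216 (2016), 1–125 … © 2016 by Institut Mittag-Leffler", PDF p. 1).  The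
STATEMENTS typed below are WORD-IDENTICAL in print; the NUMBERING differs from the arXiv numbering that PerL v5 l. 111
and the names below use: arXiv/PerL "Thm 7.8" = published **Theorem 7.2, p. 65** (PDF p0069 L48–51: "The main
automorphic ingredient of our paper is the following theorem. It is a corollary of Proposition 13.4 below whose proof
is the goal of Part 3. Theorem 7.2. Let `a` and `b` be integers such that `3(a+b)+|a−b| < 2m` and let `π_f ∈ Coh_f^{b,a}`.
Set `π = A(b×q, a×q) ⊗ π_f`. Then `π` is in the image of the `ψ`-theta correspondence from a smaller group `U(W)` of
signature `(a,b)` at infinity."); "Cor 7.9" = **Corollary 7.3, p. 66** (PDF p0070 L5–13: "Since `Z(𝔸_ℚ^f)` maps into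
`T(𝔸_ℚ^f)` via the map `ν`, it acts on the disconnected Shimura variety `S(K)` by permuting the connected components as
described in §6.5. We conclude with the following corollary. Corollary 7.3. Let `S` be any connected component of
`S(K)` and let `a` and `b` be integers such that `3(a+b)+|a−b| < 2m`. Then `H^{b×q,a×q}(S, ℂ)` is generated by classes
of theta lifts from unitary groups of signature `(a,b)` at infinity."); "Def 7.5" = **Definition 7.1, p. 64**; "§7.4
The global theta lifting" = **§7.3, p. 64**; "§7.7" (similitude convention) = **§7.5, p. 65**; Prop 13.4 = **Proposition
13.4, p. 102**; §§6.1–6.9 keep their numbers (pp. 55–61; §6.7 "Representations with cohomology" p. 59, §6.8 p. 60).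
The Lean names `Thm78` / `Cor79` keep the arXiv (= PerL) numbering; cite the print as "[BMM16, Thm 7.2 / Cor 7.3]".

This is the published statement behind `HOME/FACTS.md` row A3's informal gloss ("the theta lifts from
`U(1)`-characters … EXHAUST the … holomorphic `H^{1,0}`") and behind [Y1neg] (P1); it is typed so that the package can
point at the exact printed hypotheses (anisotropic `V`, hence compact `S(K)`; `K` neat; the degree bound
`3(a+b)+|a−b| < 2m`; the similitude-group convention of §7.7) instead of a paraphrase.  PerL v5 does NOT use it
(l. 110), and neither does any node of `HOME/LEMMAS.md`; no consumer is claimed.  Nothing in this file is PerL's,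
[Y1neg]'s or any 2001-programme statement.

STATUS OF THE SOURCE (printed caveat, quoted, not interpreted; recorded in `HOME/CITED-FACTS.md` row R7 and
`HOME/GAPS.md` cfR-N5).  [BMM] §1.9, chunk p0006 L21–25: "This is where the deep theory of Arthur comes into play. …
Arthur's work on the endoscopic classification of representations of classical groups relates the automorphic
representations of unitary groups to the automorphic representations of `GL(N)` twisted by some automorphism `θ`.
Note however that the relation is made through the stable trace formula for unitary groups and the stable trace
formula for the twisted (non connected) group `GL(N) ⋊ ⟨θ⟩`.  Thus, as pointed out in the abstract, our work is still
conditional on extensions to the twisted case of results which have only been proved so far in the case of connected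
groups. This is now announced by Waldspurger and Moeglin-Waldspurger see [WaldsSeoul]."
PUBLISHED VERSION (v2): the sentence just quoted is the arXiv text; it does NOT occur in Acta Math. 216 (2016) (no
occurrence of "conditional" in the published paper; the published paper has no abstract).  The published Introduction,
§1.4 "General strategy of proof", pp. 8–9 (PDF p0012 L40 – p0013 L4), reads instead: "This relies on Arthur's recent
endoscopic classification of automorphic representations of classical groups. Arthur's theory relates the
classification of `G` to the classification of the non-connected group `GL(N) ⋊ ⟨θ⟩` (where `θ` is some automorphism
of `GL(N)`) through the stabilization of the twisted trace formula recently obtained by Moeglin and Waldspurger [58].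
This is the subject of §12 and §13."  For the (non-quasi-split) `G` of §6.1 the published text says, §12.5 "Weak base
change", p. 94 (PDF p0098 L22–27): "The following proposition is essentially due to Arthur [3, Corollary 3.4.3] though
it is not stated for unitary groups; see [59, Corollary 4.3.8] for a statement in the latter case when `G` is
quasi-split. The reduction from the general case to the quasi-split case follows the same lines;(13) we provide some
details in Appendix A. (When Kaletha, Minguez, Shin and White have finished their three announced papers, this will
be included.)" with footnote (13) "The use of the stable twisted trace formula being replaced by the (untwisted) stable
trace formula." ([3] = Arthur's book, [59] = Mok), and Appendix A "Proof of Theorem 12.2" has §A.1 "The quasi-split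
case" (p. 103) and §A.2 "The general (non-quasi-split) case" (Theorem A.4, pp. 109–110, proof: "Here we use the
stable trace formula (A.7) for the group `G`. … Now since endoscopic groups are (products of) quasi-split unitary
groups the theorem follows from the quasi-split case").  Recorded, not adjudicated; `HOME/GAPS.md` cfR6-N3.

SETTING (verbatim, [BMM] §6.1–6.8 = arXiv Part 2 §1.1–1.8, chunks p0029–p0031).  §6.1 (p0029 L11–24): "Let `E` be a
CM-field with totally real field maximal subfield `F` with `[F:ℚ] = d`. … Let `V`, `(,)` be a nondegenerate
anisotropic Hermitian vector space over `E` with `dim_E V = m`. … `(p_i,q_i)` is the signature of `V_{τ_i}`. We will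
consider in this paper only those `V`, `(,)` such that `q_2 = … = q_d = 0` and let `(p,q) = (p_1,q_1)`. By replacing
`(,)` by `−(,)` we can, and will, assume that `p ≥ q`."  §6.2 (p0029 L64): "We let `G = Res_{F/ℚ} GU(V)`. [footnote:
… in this part of the paper `G` refers to the unitary *similitude* group and … we now refer to the usual unitary group
as `G_1`.]"  §6.4 (p0030 L52–60): "`S(K) = Sh_K(G,X)(ℂ) = G(ℚ)\(X × G(𝔸_ℚ^f))/K`. We will always choose `K` to be
*neat* … In general `S(K)` is not connected; this is a disjoint union of spaces of the type `S(Γ)`".  §6.6 (p0031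
L41–43): "Since `G` is anisotropic each `L²(G, ω)` decomposes as a direct sum of irreducible unitary representations of
`G(𝔸)` with finite multiplicities. A representation `π` which occurs in this way is called an *automorphic
representation* of `G` … We shall write `π = π_∞ ⊗ π_f` … and by `m(π)` its multiplicity in `L²(G, ω)`."  §6.7
(p0031 L51–68): "Let `Coh_∞` be the set of unitary representations `π_∞` of `G(ℝ)` (up to equivalence) such that
`H•(𝔤, K_∞; π_∞) ≠ 0` … Since we only consider cohomological representations of `G(ℝ)` having trivial central
character the classification of `Coh_∞` amounts to the Vogan-Zuckerman classification. … For any `π_f`, set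
`Inf(π_f) = {π_∞ ∈ Coh_∞ : m(π_∞ ⊗ π_f) ≠ 0}`. Let `Coh_f` be the set of `π_f` such that `Inf(π_f)` is non-empty. We
will be particularly interested in the cohomological representations `A(b×q, a×q)`; we denote by `Coh_f^{b,a}` the
set of `π_f` such that `Inf(π_f)` contains `A(b×q, a×q)`."  §6.8 (p0031 L86–87): "Given two integers `a` and `b` we
denote by `H^{b×q,a×q}(S(K), ℂ)` the part of `H•(S(K), ℂ)` which corresponds to the cohomological representation
`π_∞ = A(b×q, a×q)`".  THETA SIDE, §7.4 (p0033 L90–106): "We denote by `𝒜^c(U(W))` the set of irreducible cuspidal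
automorphic representations of `U_n(𝔸)` … `θ^f_{ψ,χ,φ}(g) = ∫_{[U_n]} θ_{ψ,χ,φ}(g,g') f(g') dg'` … We denote by
`Θ_{ψ,χ,W}^V(π')` the space of the automorphic representation generated by all `θ^f_{ψ,χ,φ}(g)` as `φ` and `f` vary,
and call `Θ_{ψ,χ,W}^V(π')` the `(ψ,χ)`-theta lifting of `π'` to `U_m(𝔸)`."  Def 7.5 (p0033 L108–111): "We say that a
representation `π ∈ 𝒜^c(U(V))` *is in the image of the cuspidal `ψ`-theta correspondence from a smaller group* if
there exists a skew-Hermitian space `W` with `dim W ≤ m`, a representation `π' ∈ 𝒜^c(U(W))` and a pair of characters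
`χ` such that `π = Θ_{ψ,χ,W}^V(π')`."  §7.7 (p0034 L28–30): "an automorphic representation `π` of `G` is in the image
of the extension to unitary similitude groups of the theta correspondence from a smaller group `GU(W)` if `π_1` is in
the image of the `ψ`-theta correspondence from `U(W)`.  In that case we will loosely say that `π` is in the image of
the `ψ`-theta correspondence from `U(W)`."

GENERALITY vs PerL.  PerL's `G_U` = the unitary group of a hermitian 3-space over the CM field `L`, of signature
`(2,1)` at one real place of `L₀ = L⁺` and definite at the `[L₀:ℚ] − 1 ≥ 1` others (PerL v5 §1.2–1.3) is such a `V`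
with `m = 3`, `(p,q) = (2,1)`, `d ≥ 2` — anisotropic because definite at some real place.  NOT covered by [BMM]: the
non-compact case `d = 1` (an indefinite hermitian space of dimension `≥ 3` over an imaginary quadratic field is
isotropic), where Rogawski's book applies instead (`Literature/Rogawski.lean`).

THE CARRIER / CLASSES (same discipline as `Literature/Rogawski.lean`, referee 2 G-R2-8).  Mathlib has no automorphic
representations: the objects the printed statements quantify over are POSITED as the fields of ONE structure
`BMMSpectrum` (types, functions and the `ℂ`-module instances of the posited cohomology groups; no propositional field),
and every printed statement is a `def … : Prop` over it whose docstring starts with its class: **P** = VERBATIM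
quotation with locator (`CohF` §6.7, `InThetaImageFrom` Def 7.5 + §7.7 + Thm 7.8's wording, `degreeBound`, `Thm78`,
`Cor79`); **DERIVED** = proved here from P-statements by elementary logic/arithmetic (`degreeBound_of_add_eq_one`,
`thm78_degree_one`, `thm78_from_line`, `cor79_degree_one`: the case `a + b = 1`, `m ≥ 3` — all of `H^{1×q, 0×q}` and
`H^{0×q, 1×q}` comes from `1`-dimensional `W`, i.e. from `U(1)`; for `m = 3` this is the sentence PerL ll. 110–112
attributes to [BMM]; for `m = n ≥ 3`, `q = 1`, `a + b = 1` it is the instance "[BMM, Proposition 13.4] (with `m=n`,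
`p=n−1`, `q=1`, `a+b=1`)" invoked by Liu, Cambridge J. Math. 9 (2021), proof of Prop. 4.13, held
`paper:arxiv-2102.11518` chunk p0020).  Nothing is asserted: a cited-but-unformalised theorem cannot be a Lean
`theorem` in this package (CONTRIBUTING.md §1), so its cited status is carried by the docstring, and a consumer takes
`(h : X.Thm78)` as an explicit hypothesis.
-/

noncomputable section

namespace HodgeCM

namespace Literature.BMM

/-- **Posited primitives** for [BMM] §§6–7 (see the module docstring for the verbatim setting).  Parameters of the
intended meaning that do not appear as fields: the CM extension `E/F`, `d = [F:ℚ]`, the anisotropic Hermitian space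
`V` of signature `(p,q)` at `τ_1` (definite elsewhere, `p ≥ q`, `p + q = m`), the additive character `ψ`, the neat
level `K`.  Fields:
* `m` — `dim_E V`;
* `RepF` — representations `π_f` of `G(𝔸_ℚ^f)`, `G = Res_{F/ℚ} GU(V)` (§6.6);
* `CohInf` — the finite set `Coh_∞` of cohomological unitary representations `π_∞` of `G(ℝ)` with trivial central
  character (§6.7); `A b a` — its element `A(b×q, a×q)` (§3 and §6.7; total in `a b : ℕ`, meaningful in the printed
  range of the Young diagrams `b×q`, `a×q`);
* `mult π_∞ π_f` — the multiplicity `m(π_∞ ⊗ π_f)` in `L²(G, ω̃)` (§6.6), so that `Inf(π_f) = {π_∞ | mult π_∞ π_f ≠ 0}`;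
* `SkewHerm` — isomorphism classes of nondegenerate skew-Hermitian spaces `W` over `E` (§7.1; "We will sometimes
  abusively refer to `W` as a Hermitian space", Remark after §7.1); `sigInf W = (a,b)` — the signature of `W` "at
  infinity", i.e. at the real place under `τ_1` (Thm 7.8: "a smaller group `U(W)` of signature `(a,b)` at
  infinity"), so that `dim_E W = a + b` (`dimW`);
* `IsThetaLiftFrom π_∞ π_f W` — "`π = π_∞ ⊗ π_f` is in the image of the `ψ`-theta correspondence from `U(W)`" in the
  sense of Def 7.5 + §7.7: there exist `π' ∈ 𝒜^c(U(W))` and a pair of characters `χ` with `π_1 = Θ^V_{ψ,χ,W}(π')`,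
  `π_1` the restriction of `π` to `G_1 = Res_{F/ℚ} U(V)`;
* `Comp` — the connected components `S` of `S(K)` (§6.4–6.5); `Coh S` — the complex vector space `H•(S, ℂ)`;
  `Hba S b a` — its subspace `H^{b×q, a×q}(S, ℂ)` (§6.8, on the component `S`); `thetaClasses S a b` — the "classes of
  theta lifts from unitary groups of signature `(a,b)` at infinity" on `S` (Cor 7.9), i.e. the classes of the forms
  `θ^f_{ψ,χ,φ}` (§7.4) for `W` with `sigInf W = (a,b)`. -/
structure BMMSpectrum : Type 1 where
  /-- `m = dim_E V` -/
  m : ℕ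
  /-- representations `π_f` of `G(𝔸_ℚ^f)` -/
  RepF : Type
  /-- `Coh_∞` -/
  CohInf : Type
  /-- `m(π_∞ ⊗ π_f)` -/
  mult : CohInf → RepF → ℕ
  /-- `A b a = A(b×q, a×q)` -/
  A : ℕ → ℕ → CohInf
  /-- skew-Hermitian spaces `W` over `E` -/
  SkewHerm : Type
  /-- signature `(a,b)` of `W` at infinity -/
  sigInf : SkewHerm → ℕ × ℕ
  /-- `π_∞ ⊗ π_f` is in the image of the `ψ`-theta correspondence from `U(W)` (Def 7.5 + §7.7) -/
  IsThetaLiftFrom : CohInf → RepF → SkewHerm → Prop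
  /-- connected components `S` of `S(K)` -/
  Comp : Type
  /-- `H•(S, ℂ)` -/
  Coh : Comp → Type
  [instAddCommGroup : ∀ S, AddCommGroup (Coh S)]
  [instModule : ∀ S, Module ℂ (Coh S)]
  /-- `H^{b×q, a×q}(S, ℂ) ⊆ H•(S, ℂ)` -/
  Hba : (S : Comp) → ℕ → ℕ → Submodule ℂ (Coh S)
  /-- classes on `S` of theta lifts from `U(W)`, `W` of signature `(a,b)` at infinity -/
  thetaClasses : (S : Comp) → ℕ → ℕ → Set (Coh S)

attribute [instance] BMMSpectrum.instAddCommGroup BMMSpectrum.instModule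

namespace BMMSpectrum

variable (X : BMMSpectrum)

/-- P (definition, [BMM] §6.7, chunk p0031 L63–68). "For any `π_f`, set `Inf(π_f) = {π_∞ ∈ Coh_∞ : m(π_∞ ⊗ π_f) ≠ 0}`.
… we denote by `Coh_f^{b,a}` the set of `π_f` such that `Inf(π_f)` contains `A(b×q, a×q)`."  So
`π_f ∈ Coh_f^{b,a} ⟺ m(A(b×q, a×q) ⊗ π_f) ≠ 0`. [cite: BMM16, §6.7] -/
def CohF (b a : ℕ) : Set X.RepF := {πf | X.mult (X.A b a) πf ≠ 0}

/-- (Ported verbatim from the HodgeCMPerL package; no docstring in the source.) -/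
theorem mem_cohF_iff {b a : ℕ} {πf : X.RepF} : πf ∈ X.CohF b a ↔ X.mult (X.A b a) πf ≠ 0 := Iff.rfl

/-- `dim_E W = a + b` for `W` of signature `(a,b)` at infinity (definitional for a nondegenerate form). -/
def dimW (W : X.SkewHerm) : ℕ := (X.sigInf W).1 + (X.sigInf W).2

/-- P (the conclusion of [BMM] Thm 7.8 as a predicate, chunk p0034 L34–36 with Def 7.5 p0033 L108–111 and §7.7
p0034 L28–30): "`π` is in the image of the `ψ`-theta correspondence from a smaller group `U(W)` of signature `(a,b)`
at infinity" — there EXISTS a skew-Hermitian `W` over `E` of signature `(a,b)` at infinity from whose unitary group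
`π = π_∞ ⊗ π_f` is a `ψ`-theta lift. [cite: BMM16, Def 7.5, §7.7, Thm 7.8] -/
def InThetaImageFrom (πinf : X.CohInf) (πf : X.RepF) (a b : ℕ) : Prop :=
  ∃ W : X.SkewHerm, X.sigInf W = (a, b) ∧ X.IsThetaLiftFrom πinf πf W

/-- P (the printed hypothesis of Thm 7.8 / Cor 7.9, chunk p0034 L35 and L46): "Let `a` and `b` be integers s.t.
`3(a+b)+|a−b| < 2m`" (stated in `ℤ`; `a, b ≥ 0` index the Young diagrams `a×q`, `b×q`). [cite: BMM16, Thm 7.8] -/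
def degreeBound (a b : ℕ) : Prop := 3 * ((a : ℤ) + b) + |(a : ℤ) - b| < 2 * (X.m : ℤ)

/-- P. **[BMM] Theorem 7.8** (chunk p0034 L32–36, "The main automorphic ingredient of our paper is the following
theorem."): "Let `a` and `b` be integers s.t. `3(a+b)+|a−b| < 2m` and let `π_f ∈ Coh_f^{b,a}`. Set
`π = A(b×q, a×q) ⊗ π_f`, then `π` is in the image of the `ψ`-theta correspondence from a smaller group `U(W)` of
signature `(a,b)` at infinity."  Printed proof (p0034 L38–41): "The proof of this theorem is the goal of Part 3. …
the theorem follows from Proposition (prop:main) which is stated and proved in Part 3. The only remaining thing to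
be proved is that the signature at infinity is `(a,b)`: this follows from the fact that `A(b×q, a×q)` is the image of
the local theta correspondance from a group `U(W, ℂ/ℝ)` of dimension `a+b` if and only if the signature is `(a,b)`.
This follows from work of Annegret Paul [Paul]."  Setting and status of the source: module docstring.
[cite: BMM16, Thm 7.8 (Acta Math. 216 (2016); arXiv:1306.1515 Part 2 §2.6)] -/
def Thm78 : Prop :=
  ∀ (a b : ℕ) (πf : X.RepF), X.degreeBound a b → πf ∈ X.CohF b a → X.InThetaImageFrom (X.A b a) πf a b

/-- P. **[BMM] Corollary 7.9** (chunk p0034 L43–47): "Since `Z(𝔸_ℚ^f)` embeds into `T(𝔸_ℚ^f)` via the map `ν`, it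
acts on the disconnected Shimura variety `S(K)` by permuting the connected components. As a corollary we conclude:
Corollary. Let `S` be any connected component of `S(K)` and let `a` and `b` be integers such that
`3(a+b)+|a−b| < 2m`. Then `H^{b×q, a×q}(S, ℂ)` is generated by classes of theta lifts from unitary groups of
signature `(a,b)` at infinity."  TYPED AS the containment `H^{b×q,a×q}(S, ℂ) ≤ span_ℂ (those classes)`, which is
what "is generated by" asserts about `H^{b×q,a×q}(S, ℂ)`; the converse containment (the theta classes of signature
`(a,b)` lie in that Hodge summand) is not typed.  (The coefficient field `ℂ` of `H^{b×q,a×q}(S, ·)` is dropped by the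
extraction at L46 and restored from §6.8.) [cite: BMM16, Cor 7.9] -/
def Cor79 : Prop :=
  ∀ (S : X.Comp) (a b : ℕ), X.degreeBound a b → X.Hba S b a ≤ Submodule.span ℂ (X.thetaClasses S a b)

/-! ### DERIVED: the degree-one case (`a + b = 1`), i.e. `H^{1×q,0×q} ⊕ H^{0×q,1×q}` — for `q = 1`, `H^{1,0} ⊕ H^{0,1}` -/

/-- DERIVED (arithmetic). For `a + b = 1` the printed bound `3(a+b)+|a−b| < 2m` reads `4 < 2m`, i.e. `m ≥ 3`. -/
theorem degreeBound_iff_of_add_eq_one {a b : ℕ} (hab : a + b = 1) : X.degreeBound a b ↔ 3 ≤ X.m := by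
  unfold degreeBound
  rcases Nat.eq_zero_or_pos a with ha | ha
  · subst ha
    have hb : b = 1 := by omega
    subst hb
    norm_num
    omega
  · have hb : b = 0 := by omega
    have ha1 : a = 1 := by omega
    subst hb ha1
    norm_num
    omega

/-- (Ported verbatim from the HodgeCMPerL package; no docstring in the source.) -/
theorem degreeBound_of_add_eq_one {a b : ℕ} (hab : a + b = 1) (hm : 3 ≤ X.m) : X.degreeBound a b :=
  (X.degreeBound_iff_of_add_eq_one hab).2 hm

/-- DERIVED. Thm 7.8 in degree one, `m ≥ 3`: every `π_f` contributing to `H^{1×q, 0×q}` (`π_f ∈ Coh_f^{1,0}`) is,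
with `π_∞ = A(1×q, 0×q)`, a `ψ`-theta lift from a `U(W)` of signature `(0,1)` at infinity, and every `π_f ∈ Coh_f^{0,1}`
one from signature `(1,0)`; in both cases `dim_E W = 1` (`thm78_from_line`).  For `m = 3`, `(p,q) = (2,1)`, `d ≥ 2`
this is the statement PerL v5 ll. 110–112 attributes to [BMM, Thm 7.8, Cor 7.9] ("every `π ∈ 𝒜^{1,0}` is a global
theta lift from the unitary group of a hermitian line"); which of the two summands is PerL's `𝒜^{1,0}` is the
Hodge-type convention of [BMM] §6.8 / §1.7(2) (`H^{b×q,a×q} ↔ A(b×q,a×q)`; for `q = 1`, `H^{a,b} ⊕ H^{b,a}`), not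
decided here. -/
theorem thm78_degree_one (h : X.Thm78) (hm : 3 ≤ X.m) :
    (∀ πf ∈ X.CohF 1 0, X.InThetaImageFrom (X.A 1 0) πf 0 1) ∧
    (∀ πf ∈ X.CohF 0 1, X.InThetaImageFrom (X.A 0 1) πf 1 0) :=
  ⟨fun πf hπ => h 0 1 πf (X.degreeBound_of_add_eq_one (by norm_num) hm) hπ,
   fun πf hπ => h 1 0 πf (X.degreeBound_of_add_eq_one (by norm_num) hm) hπ⟩

/-- DERIVED. Same, stated with the dimension: the lifting group is the unitary group of a LINE (`dim_E W = 1`). -/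
theorem thm78_from_line (h : X.Thm78) (hm : 3 ≤ X.m) {a b : ℕ} (hab : a + b = 1) {πf : X.RepF}
    (hπ : πf ∈ X.CohF b a) : ∃ W : X.SkewHerm, X.dimW W = 1 ∧ X.IsThetaLiftFrom (X.A b a) πf W := by
  obtain ⟨W, hsig, hW⟩ := h a b πf (X.degreeBound_of_add_eq_one hab hm) hπ
  refine ⟨W, ?_, hW⟩
  simp only [dimW, hsig]
  exact hab

/-- DERIVED. Cor 7.9 in degree one, `m ≥ 3`: on every connected component `S` of `S(K)`, `H^{1×q,0×q}(S, ℂ)` is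
contained in the span of the classes of theta lifts from unitary groups of signature `(0,1)` at infinity, and
`H^{0×q,1×q}(S, ℂ)` in the span of those of signature `(1,0)`. -/
theorem cor79_degree_one (h : X.Cor79) (hm : 3 ≤ X.m) (S : X.Comp) :
    X.Hba S 1 0 ≤ Submodule.span ℂ (X.thetaClasses S 0 1) ∧
    X.Hba S 0 1 ≤ Submodule.span ℂ (X.thetaClasses S 1 0) :=
  ⟨h S 0 1 (X.degreeBound_of_add_eq_one (by norm_num) hm), h S 1 0 (X.degreeBound_of_add_eq_one (by norm_num) hm)⟩

/-- DERIVED (sanity of the bound in the other direction): for `m ≤ 2` the printed hypothesis is never satisfied, so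
Thm 7.8 / Cor 7.9 say nothing about curves (`m = 2`). -/
theorem not_degreeBound_of_le_two (hm : X.m ≤ 2) (a b : ℕ) (hab : 1 ≤ a + b) : ¬ X.degreeBound a b := by
  unfold degreeBound
  have h1 : (a : ℤ) - b ≤ |(a : ℤ) - b| := le_abs_self _
  have h2 : -((a : ℤ) - b) ≤ |(a : ℤ) - b| := neg_le_abs _
  omega

end BMMSpectrum

end Literature.BMM

end HodgeCM

end
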